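/-
Copyright (c) 2026. Released under Apache 2.0 license.
-/
import Literature.NumberTheory.Automorphic.UnboundedDenominatorsLayerCoordinates
import HarnessLib

/-!
# The layers `Γ(q)/Γ(qp) ≅ 𝔰𝔩₂(𝔽_p)` (`p ∣ q`): coordinates and the adjoint action

Generalisation of `UnboundedDenominatorsLayerCoordinates` from the first layer `Γ(p)/Γ(p²)` to an arbitrary
layer `Γ(q)/Γ(qp)` with `p ∣ q` (e.g. `q = p^j`, `j ≥ 1`): the coordinates `((x₀₀-1)/q, x₀₁/q, x₁₀/q) mod p`
form a homomorphism `Φ : Γ(q) → (ℤ/p)³` with kernel `Γ(qp)`, and **conjugation by any `g ∈ SL₂(ℤ)` acts on the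
coordinates by the adjoint action of `g mod p` on trace-zero matrices** (`Ad(g)X = gXg⁻¹`): if
`Φ(x) = (α, β, κ)` and `g ≡ (a b; c d) (mod p)` then
`Φ(gxg⁻¹) = ((ad+bc)α + bdκ - acβ, a²β - b²κ - 2abα, d²κ - c²β + 2cdα)`.  Also the values on `T^q`,
`S T^q S⁻¹` and the normal form of the layer.  These are the tools for the layer analysis at depth `e ≥ 3` of
the `p`-adic core of the invariant form of [CalegariDimitrovTang2025, Corollary 4.5.3] ([Beyl1986]).
-/

open scoped MatrixGroups commutatorElement

namespace Literature.NumberTheory.Automorphic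

namespace UnboundedDenominators

open CongruenceSubgroup Matrix.SpecialLinearGroup ModularGroup

/-- Entries of an element of `Γ(M)`: `x = 1 + M X` with `X` integral. [folklore] -/
private theorem exists_entries_eq'' {M : ℕ} {x : SL(2, ℤ)} (hx : x ∈ Gamma M) :
    ∃ α β κ δ : ℤ, (x 0 0 : ℤ) = 1 + M * α ∧ (x 0 1 : ℤ) = M * β ∧ (x 1 0 : ℤ) = M * κ ∧
      (x 1 1 : ℤ) = 1 + M * δ := by
  obtain ⟨h00, h01, h10, h11⟩ := Gamma_mem.mp hx
  obtain ⟨α, hα⟩ := (ZMod.intCast_eq_intCast_iff_dvd_sub 1 (x 0 0) M).mp (by simpa using h00.symm)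
  obtain ⟨β, hβ⟩ := (ZMod.intCast_zmod_eq_zero_iff_dvd _ M).mp h01
  obtain ⟨κ, hκ⟩ := (ZMod.intCast_zmod_eq_zero_iff_dvd _ M).mp h10
  obtain ⟨δ, hδ⟩ := (ZMod.intCast_eq_intCast_iff_dvd_sub 1 (x 1 1) M).mp (by simpa using h11.symm)
  exact ⟨α, β, κ, δ, by linear_combination hα, hβ, hκ, by linear_combination hδ⟩

/-- The trace condition: for `x = 1 + M X ∈ SL₂(ℤ)`, `tr X = -M det X`. [folklore] -/
private theorem trace_eq'' {M : ℕ} (hM : (M : ℤ) ≠ 0) (x : SL(2, ℤ)) (α β κ δ : ℤ)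
    (ha : (x 0 0 : ℤ) = 1 + M * α) (hb : (x 0 1 : ℤ) = M * β) (hc : (x 1 0 : ℤ) = M * κ)
    (hd : (x 1 1 : ℤ) = 1 + M * δ) : α + δ = -(M * (α * δ - β * κ)) := by
  have hdet := det_coe x
  rw [Matrix.det_fin_two, ha, hb, hc, hd] at hdet
  have h1 : (M : ℤ) * (α + δ + M * (α * δ - β * κ)) = 0 := by linear_combination hdet
  have h2 := (mul_eq_zero.mp h1).resolve_left hM
  linear_combination h2

/-- Membership in `Γ(qp)` from entries `1 + qp(…)`. [folklore] -/
private theorem mem_Gamma_mul_of_entries {q p : ℕ} {x : SL(2, ℤ)} (α β κ δ : ℤ)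
    (ha : (x 0 0 : ℤ) = 1 + q * α) (hb : (x 0 1 : ℤ) = q * β) (hc : (x 1 0 : ℤ) = q * κ)
    (hd : (x 1 1 : ℤ) = 1 + q * δ) (hα : (p : ℤ) ∣ α) (hβ : (p : ℤ) ∣ β) (hκ : (p : ℤ) ∣ κ)
    (hδ : (p : ℤ) ∣ δ) : x ∈ Gamma (q * p) := by
  obtain ⟨α', rfl⟩ := hα
  obtain ⟨β', rfl⟩ := hβ
  obtain ⟨κ', rfl⟩ := hκ
  obtain ⟨δ', rfl⟩ := hδ
  have hv : ∀ z : ℤ, (((q : ℤ) * (p * z) : ℤ) : ZMod (q * p)) = 0 := fun z ↦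
    (ZMod.intCast_zmod_eq_zero_iff_dvd _ _).mpr ⟨z, by push_cast; ring⟩
  rw [Gamma_mem]
  refine ⟨?_, ?_, ?_, ?_⟩
  · rw [ha, Int.cast_add, Int.cast_one, hv, add_zero]
  · rw [hb, hv]
  · rw [hc, hv]
  · rw [hd, Int.cast_add, Int.cast_one, hv, add_zero]

/-- **Coordinates of the layer `Γ(q)/Γ(qp)` for `p ∣ q`** and the adjoint action on them.  There is a
homomorphism `Φ : Γ(q) → (ℤ/p)³`, `Φ(1 + qX) = (X₀₀, X₀₁, X₁₀) mod p`, with: (1) the evaluation rule; (2) `Φ`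
kills `Γ(qp)`; (3) `Φ(x) = 1 ⟹ x ∈ Γ(qp)`; (4) for every `g ∈ SL₂(ℤ)`, `Φ(gxg⁻¹)` is given by `Ad(g mod p)`:
`((ad+bc)α + bdκ - acβ, a²β - b²κ - 2abα, d²κ - c²β + 2cdα)` where `(a b; c d) = g mod p`; (5)
`Φ(T^q) = (0,1,0)`; (6) `Φ(S T^q S⁻¹) = (0,0,-1)`; (7) the normal form: every `x ∈ Γ(q)` is `u_H^i u_E^j u_F^k`
modulo `Γ(qp)` for any three elements with coordinates `(-1,1,-1)`, `(0,1,0)`, `(0,0,-1)`.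
[cite: CalegariDimitrovTang2025, §4.5] [cite: Beyl1986, Theorem] -/
theorem exists_layerCoord_mul (q p : ℕ) (hq : q ≠ 0) (hpq : p ∣ q) :
    ∃ Φ : Gamma q →* Multiplicative (ZMod p × ZMod p × ZMod p),
      (∀ (x : SL(2, ℤ)) (hx : x ∈ Gamma q) (α β κ : ℤ), (x 0 0 : ℤ) = 1 + q * α → (x 0 1 : ℤ) = q * β →
        (x 1 0 : ℤ) = q * κ → Φ ⟨x, hx⟩ = Multiplicative.ofAdd ((α : ZMod p), (β : ZMod p), (κ : ZMod p))) ∧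
      (∀ (x : SL(2, ℤ)) (hx : x ∈ Gamma q), x ∈ Gamma (q * p) → Φ ⟨x, hx⟩ = 1) ∧
      (∀ (x : SL(2, ℤ)) (hx : x ∈ Gamma q), Φ ⟨x, hx⟩ = 1 → x ∈ Gamma (q * p)) ∧
      (∀ (g x : SL(2, ℤ)) (hx : x ∈ Gamma q) (hgx : g * x * g⁻¹ ∈ Gamma q) (α β κ : ZMod p),
        Φ ⟨x, hx⟩ = Multiplicative.ofAdd (α, β, κ) →
        Φ ⟨g * x * g⁻¹, hgx⟩ = Multiplicative.ofAdd
          ((((g 0 0 : ℤ) : ZMod p) * (g 1 1 : ℤ) + ((g 0 1 : ℤ) : ZMod p) * (g 1 0 : ℤ)) * α +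
              ((g 0 1 : ℤ) : ZMod p) * (g 1 1 : ℤ) * κ - ((g 0 0 : ℤ) : ZMod p) * (g 1 0 : ℤ) * β,
            ((g 0 0 : ℤ) : ZMod p) ^ 2 * β - ((g 0 1 : ℤ) : ZMod p) ^ 2 * κ -
              2 * ((g 0 0 : ℤ) : ZMod p) * (g 0 1 : ℤ) * α,
            ((g 1 1 : ℤ) : ZMod p) ^ 2 * κ - ((g 1 0 : ℤ) : ZMod p) ^ 2 * β +
              2 * ((g 1 0 : ℤ) : ZMod p) * (g 1 1 : ℤ) * α)) ∧
      (∀ hT : T ^ q ∈ Gamma q, Φ ⟨T ^ q, hT⟩ = Multiplicative.ofAdd (0, 1, 0)) ∧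
      (∀ hF : S * T ^ q * S⁻¹ ∈ Gamma q, Φ ⟨S * T ^ q * S⁻¹, hF⟩ = Multiplicative.ofAdd (0, 0, -1)) ∧
      (∀ (uH uE uF : SL(2, ℤ)) (hH : uH ∈ Gamma q) (hE : uE ∈ Gamma q) (hF : uF ∈ Gamma q),
        Φ ⟨uH, hH⟩ = Multiplicative.ofAdd (-1, 1, -1) → Φ ⟨uE, hE⟩ = Multiplicative.ofAdd (0, 1, 0) →
        Φ ⟨uF, hF⟩ = Multiplicative.ofAdd (0, 0, -1) →
        ∀ (x : SL(2, ℤ)), x ∈ Gamma q →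
          ∃ i j k : ℤ, x * (uH ^ i * uE ^ j * uF ^ k)⁻¹ ∈ Gamma (q * p)) := by
  have hq' : (q : ℤ) ≠ 0 := by exact_mod_cast hq
  have hqp : (q : ZMod p) = 0 := (ZMod.natCast_eq_zero_iff q p).mpr hpq
  -- the function
  let F : Gamma q → ZMod p × ZMod p × ZMod p := fun γ ↦
    (((((γ : SL(2, ℤ)) 0 0 - 1) / q : ℤ) : ZMod p), ((((γ : SL(2, ℤ)) 0 1) / q : ℤ) : ZMod p),
      ((((γ : SL(2, ℤ)) 1 0) / q : ℤ) : ZMod p))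
  have hF : ∀ (γ : Gamma q) (α β κ : ℤ), ((γ : SL(2, ℤ)) 0 0 : ℤ) = 1 + q * α →
      ((γ : SL(2, ℤ)) 0 1 : ℤ) = q * β → ((γ : SL(2, ℤ)) 1 0 : ℤ) = q * κ →
      F γ = ((α : ZMod p), (β : ZMod p), (κ : ZMod p)) := by
    intro γ α β κ ha hb hc
    simp only [F]
    rw [ha, hb, hc, add_sub_cancel_left, Int.mul_ediv_cancel_left _ hq', Int.mul_ediv_cancel_left _ hq',
      Int.mul_ediv_cancel_left _ hq']
  -- multiplicativity
  have hmul : ∀ γ γ' : Gamma q, F (γ * γ') = F γ + F γ' := by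
    intro γ γ'
    obtain ⟨α, β, κ, δ, ha, hb, hc, hd⟩ := exists_entries_eq'' γ.2
    obtain ⟨α', β', κ', δ', ha', hb', hc', hd'⟩ := exists_entries_eq'' γ'.2
    have e00 : (((γ * γ' : Gamma q) : SL(2, ℤ)) 0 0 : ℤ) = 1 + q * (α + α' + q * (α * α' + β * κ')) := by
      have : (((γ * γ' : Gamma q) : SL(2, ℤ)) 0 0 : ℤ) = (γ : SL(2, ℤ)) 0 0 * (γ' : SL(2, ℤ)) 0 0 +
          (γ : SL(2, ℤ)) 0 1 * (γ' : SL(2, ℤ)) 1 0 := by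
        simp [Matrix.mul_apply, Fin.sum_univ_two]
      rw [this, ha, hb, ha', hc']; ring
    have e01 : (((γ * γ' : Gamma q) : SL(2, ℤ)) 0 1 : ℤ) = q * (β + β' + q * (α * β' + β * δ')) := by
      have : (((γ * γ' : Gamma q) : SL(2, ℤ)) 0 1 : ℤ) = (γ : SL(2, ℤ)) 0 0 * (γ' : SL(2, ℤ)) 0 1 +
          (γ : SL(2, ℤ)) 0 1 * (γ' : SL(2, ℤ)) 1 1 := by
        simp [Matrix.mul_apply, Fin.sum_univ_two]
      rw [this, ha, hb, hb', hd']; ring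
    have e10 : (((γ * γ' : Gamma q) : SL(2, ℤ)) 1 0 : ℤ) = q * (κ + κ' + q * (κ * α' + δ * κ')) := by
      have : (((γ * γ' : Gamma q) : SL(2, ℤ)) 1 0 : ℤ) = (γ : SL(2, ℤ)) 1 0 * (γ' : SL(2, ℤ)) 0 0 +
          (γ : SL(2, ℤ)) 1 1 * (γ' : SL(2, ℤ)) 1 0 := by
        simp [Matrix.mul_apply, Fin.sum_univ_two]
      rw [this, hc, hd, ha', hc']; ring
    rw [hF _ _ _ _ e00 e01 e10, hF γ α β κ ha hb hc, hF γ' α' β' κ' ha' hb' hc', Prod.mk_add_mk,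
      Prod.mk_add_mk, Int.cast_add, Int.cast_add, Int.cast_mul, Int.cast_natCast, hqp, zero_mul, add_zero,
      Int.cast_add, Int.cast_add, Int.cast_mul, Int.cast_natCast, hqp, zero_mul, add_zero,
      Int.cast_add, Int.cast_add, Int.cast_mul, Int.cast_natCast, hqp, zero_mul, add_zero]
  have hone : F 1 = 0 := by
    rw [hF 1 0 0 0 (by simp) (by simp) (by simp)]
    push_cast
    rfl
  let Φ : Gamma q →* Multiplicative (ZMod p × ZMod p × ZMod p) :=
    { toFun := fun γ ↦ Multiplicative.ofAdd (F γ)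
      map_one' := by rw [hone, ofAdd_zero]
      map_mul' := fun a b ↦ by rw [hmul, ofAdd_add] }
  have hΦ : ∀ γ, Φ γ = Multiplicative.ofAdd (F γ) := fun γ ↦ rfl
  -- (1) evaluation
  have P1 : ∀ (x : SL(2, ℤ)) (hx : x ∈ Gamma q) (α β κ : ℤ), (x 0 0 : ℤ) = 1 + q * α →
      (x 0 1 : ℤ) = q * β → (x 1 0 : ℤ) = q * κ →
      Φ ⟨x, hx⟩ = Multiplicative.ofAdd ((α : ZMod p), (β : ZMod p), (κ : ZMod p)) := by
    intro x hx α β κ ha hb hc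
    rw [hΦ, hF ⟨x, hx⟩ α β κ ha hb hc]
  -- (2) kills `Γ(qp)`
  have P2 : ∀ (x : SL(2, ℤ)) (hx : x ∈ Gamma q), x ∈ Gamma (q * p) → Φ ⟨x, hx⟩ = 1 := by
    intro x hx hx2
    obtain ⟨α, β, κ, δ, ha, hb, hc, hd⟩ := exists_entries_eq'' hx2
    rw [P1 x hx (p * α) (p * β) (p * κ) (by rw [ha]; push_cast; ring) (by rw [hb]; push_cast; ring)
      (by rw [hc]; push_cast; ring)]
    push_cast
    rw [ZMod.natCast_self, zero_mul, zero_mul, zero_mul]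
    rfl
  -- (3) kernel
  have P3 : ∀ (x : SL(2, ℤ)) (hx : x ∈ Gamma q), Φ ⟨x, hx⟩ = 1 → x ∈ Gamma (q * p) := by
    intro x hx h1
    obtain ⟨α, β, κ, δ, ha, hb, hc, hd⟩ := exists_entries_eq'' hx
    rw [P1 x hx α β κ ha hb hc] at h1
    have h2 : ((α : ZMod p), (β : ZMod p), (κ : ZMod p)) = 0 := by
      rw [← ofAdd_zero] at h1
      exact Multiplicative.ofAdd.injective h1
    simp only [Prod.mk_eq_zero, ZMod.intCast_zmod_eq_zero_iff_dvd] at h2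
    obtain ⟨hα, hβ, hκ⟩ := h2
    have htr := trace_eq'' hq' x α β κ δ ha hb hc hd
    have hpq' : (p : ℤ) ∣ q := by exact_mod_cast hpq
    have hδ : (p : ℤ) ∣ δ := by
      have : δ = -(q * (α * δ - β * κ)) - α := by linear_combination htr
      rw [this]
      exact dvd_sub (dvd_neg.mpr (dvd_mul_of_dvd_left hpq' _)) hα
    exact mem_Gamma_mul_of_entries α β κ δ ha hb hc hd hα hβ hκ hδ
  -- (4) the adjoint action
  have P4 : ∀ (g x : SL(2, ℤ)) (hx : x ∈ Gamma q) (hgx : g * x * g⁻¹ ∈ Gamma q) (α β κ : ZMod p),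
      Φ ⟨x, hx⟩ = Multiplicative.ofAdd (α, β, κ) →
      Φ ⟨g * x * g⁻¹, hgx⟩ = Multiplicative.ofAdd
        ((((g 0 0 : ℤ) : ZMod p) * (g 1 1 : ℤ) + ((g 0 1 : ℤ) : ZMod p) * (g 1 0 : ℤ)) * α +
            ((g 0 1 : ℤ) : ZMod p) * (g 1 1 : ℤ) * κ - ((g 0 0 : ℤ) : ZMod p) * (g 1 0 : ℤ) * β,
          ((g 0 0 : ℤ) : ZMod p) ^ 2 * β - ((g 0 1 : ℤ) : ZMod p) ^ 2 * κ -
            2 * ((g 0 0 : ℤ) : ZMod p) * (g 0 1 : ℤ) * α,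
          ((g 1 1 : ℤ) : ZMod p) ^ 2 * κ - ((g 1 0 : ℤ) : ZMod p) ^ 2 * β +
            2 * ((g 1 0 : ℤ) : ZMod p) * (g 1 1 : ℤ) * α) := by
    intro g x hx hgx α β κ h
    obtain ⟨X, hX⟩ := exists_eq_one_add_smul_of_mem_Gamma hx
    have hXe : ∀ i j, (x i j : ℤ) = (1 : Matrix (Fin 2) (Fin 2) ℤ) i j + q * X i j := by
      intro i j
      rw [show (x i j : ℤ) = (x : Matrix (Fin 2) (Fin 2) ℤ) i j from rfl, hX, Matrix.add_apply,
        Matrix.smul_apply, smul_eq_mul]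
    have ha : (x 0 0 : ℤ) = 1 + q * X 0 0 := by simpa using hXe 0 0
    have hb : (x 0 1 : ℤ) = q * X 0 1 := by simpa using hXe 0 1
    have hc : (x 1 0 : ℤ) = q * X 1 0 := by simpa using hXe 1 0
    have hd : (x 1 1 : ℤ) = 1 + q * X 1 1 := by simpa using hXe 1 1
    rw [P1 x hx (X 0 0) (X 0 1) (X 1 0) ha hb hc] at h
    have h' : (((X 0 0 : ℤ) : ZMod p), ((X 0 1 : ℤ) : ZMod p), ((X 1 0 : ℤ) : ZMod p)) = (α, β, κ) :=
      Multiplicative.ofAdd.injective h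
    simp only [Prod.mk.injEq] at h'
    obtain ⟨hα, hβ, hκ⟩ := h'
    have htr := trace_eq'' hq' x (X 0 0) (X 0 1) (X 1 0) (X 1 1) ha hb hc hd
    have hδ : ((X 1 1 : ℤ) : ZMod p) = -α := by
      have : X 1 1 = -(q * (X 0 0 * X 1 1 - X 0 1 * X 1 0)) - X 0 0 := by linear_combination htr
      rw [this, ← hα]; push_cast; rw [hqp]; ring
    -- `g x g⁻¹ = 1 + q · (g X g⁻¹)`
    set Y : Matrix (Fin 2) (Fin 2) ℤ :=
      (g : Matrix (Fin 2) (Fin 2) ℤ) * X * ((g⁻¹ : SL(2, ℤ)) : Matrix (Fin 2) (Fin 2) ℤ) with hY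
    have hgg : (g : Matrix (Fin 2) (Fin 2) ℤ) * ((g⁻¹ : SL(2, ℤ)) : Matrix (Fin 2) (Fin 2) ℤ) = 1 := by
      rw [← Matrix.SpecialLinearGroup.coe_mul, mul_inv_cancel, Matrix.SpecialLinearGroup.coe_one]
    have hconj : ((g * x * g⁻¹ : SL(2, ℤ)) : Matrix (Fin 2) (Fin 2) ℤ) = 1 + (q : ℤ) • Y := by
      rw [Matrix.SpecialLinearGroup.coe_mul, Matrix.SpecialLinearGroup.coe_mul, hX, Matrix.mul_add,
        Matrix.mul_one, Matrix.add_mul, hgg, Matrix.mul_smul, Matrix.smul_mul, hY, Matrix.mul_assoc]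
    have hYe : ∀ i j, ((g * x * g⁻¹ : SL(2, ℤ)) i j : ℤ) = (1 : Matrix (Fin 2) (Fin 2) ℤ) i j + q * Y i j := by
      intro i j
      rw [show ((g * x * g⁻¹ : SL(2, ℤ)) i j : ℤ) = ((g * x * g⁻¹ : SL(2, ℤ)) : Matrix (Fin 2) (Fin 2) ℤ) i j
        from rfl, hconj, Matrix.add_apply, Matrix.smul_apply, smul_eq_mul]
    have ga : ((g * x * g⁻¹ : SL(2, ℤ)) 0 0 : ℤ) = 1 + q * Y 0 0 := by simpa using hYe 0 0
    have gb : ((g * x * g⁻¹ : SL(2, ℤ)) 0 1 : ℤ) = q * Y 0 1 := by simpa using hYe 0 1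
    have gc : ((g * x * g⁻¹ : SL(2, ℤ)) 1 0 : ℤ) = q * Y 1 0 := by simpa using hYe 1 0
    rw [P1 _ hgx (Y 0 0) (Y 0 1) (Y 1 0) ga gb gc]
    -- entries of `g⁻¹` and of `Y`
    have hgi : ((g⁻¹ : SL(2, ℤ)) : Matrix (Fin 2) (Fin 2) ℤ) = !![g 1 1, -g 0 1; -g 1 0, g 0 0] := by
      rw [Matrix.SpecialLinearGroup.coe_inv, Matrix.adjugate_fin_two]
    have i00 : ((g⁻¹ : SL(2, ℤ)) : Matrix (Fin 2) (Fin 2) ℤ) 0 0 = g 1 1 := by rw [hgi]; simp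
    have i01 : ((g⁻¹ : SL(2, ℤ)) : Matrix (Fin 2) (Fin 2) ℤ) 0 1 = -g 0 1 := by rw [hgi]; simp
    have i10 : ((g⁻¹ : SL(2, ℤ)) : Matrix (Fin 2) (Fin 2) ℤ) 1 0 = -g 1 0 := by rw [hgi]; simp
    have i11 : ((g⁻¹ : SL(2, ℤ)) : Matrix (Fin 2) (Fin 2) ℤ) 1 1 = g 0 0 := by rw [hgi]; simp
    have y00 : Y 0 0 = (g 0 0 * X 0 0 + g 0 1 * X 1 0) * g 1 1 + (g 0 0 * X 0 1 + g 0 1 * X 1 1) * (-g 1 0) := by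
      simp only [hY, Matrix.mul_apply, Fin.sum_univ_two, i00, i10]
    have y01 : Y 0 1 = (g 0 0 * X 0 0 + g 0 1 * X 1 0) * (-g 0 1) + (g 0 0 * X 0 1 + g 0 1 * X 1 1) * g 0 0 := by
      simp only [hY, Matrix.mul_apply, Fin.sum_univ_two, i01, i11]
    have y10 : Y 1 0 = (g 1 0 * X 0 0 + g 1 1 * X 1 0) * g 1 1 + (g 1 0 * X 0 1 + g 1 1 * X 1 1) * (-g 1 0) := by
      simp only [hY, Matrix.mul_apply, Fin.sum_univ_two, i00, i10]
    have z00 := congrArg (fun z : ℤ ↦ (z : ZMod p)) y00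
    have z01 := congrArg (fun z : ℤ ↦ (z : ZMod p)) y01
    have z10 := congrArg (fun z : ℤ ↦ (z : ZMod p)) y10
    simp only [Int.cast_add, Int.cast_mul, Int.cast_neg] at z00 z01 z10
    rw [hα, hβ, hκ, hδ] at z00 z01 z10
    congr 1
    refine Prod.ext ?_ (Prod.ext ?_ ?_)
    · simp only; linear_combination z00
    · simp only; linear_combination z01
    · simp only; linear_combination z10
  -- (5) `T^q`
  have hTq : ((T ^ q : SL(2, ℤ)) : Matrix (Fin 2) (Fin 2) ℤ) = !![1, (q : ℤ); 0, 1] := by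
    rw [show (T ^ q : SL(2, ℤ)) = T ^ (q : ℤ) from (zpow_natCast T q).symm]
    exact coe_T_zpow (q : ℤ)
  have P5 : ∀ hT : T ^ q ∈ Gamma q, Φ ⟨T ^ q, hT⟩ = Multiplicative.ofAdd (0, 1, 0) := by
    intro hT
    rw [P1 _ hT 0 1 0 (by simp [hTq]) (by simp [hTq]) (by simp [hTq])]
    push_cast
    rfl
  -- (6) `S T^q S⁻¹`, from (4) and (5)
  have P6 : ∀ hF' : S * T ^ q * S⁻¹ ∈ Gamma q,
      Φ ⟨S * T ^ q * S⁻¹, hF'⟩ = Multiplicative.ofAdd (0, 0, -1) := by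
    intro hF'
    have hT : T ^ q ∈ Gamma q := by
      have h := (Gamma_normal q).conj_mem _ hF' S⁻¹
      rwa [inv_inv, show S⁻¹ * (S * T ^ q * S⁻¹) * S = T ^ q by group] at h
    rw [P4 S (T ^ q) hT hF' 0 1 0 (P5 hT)]
    have s00 : ((S : SL(2, ℤ)) 0 0 : ℤ) = 0 := by simp [coe_S]
    have s01 : ((S : SL(2, ℤ)) 0 1 : ℤ) = -1 := by simp [coe_S]
    have s10 : ((S : SL(2, ℤ)) 1 0 : ℤ) = 1 := by simp [coe_S]
    have s11 : ((S : SL(2, ℤ)) 1 1 : ℤ) = 0 := by simp [coe_S]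
    rw [s00, s01, s10, s11]
    push_cast
    congr 1
    refine Prod.ext ?_ (Prod.ext ?_ ?_) <;> simp
  -- (7) normal form
  have P7 : ∀ (uH uE uF : SL(2, ℤ)) (hH : uH ∈ Gamma q) (hE : uE ∈ Gamma q) (hF' : uF ∈ Gamma q),
      Φ ⟨uH, hH⟩ = Multiplicative.ofAdd (-1, 1, -1) → Φ ⟨uE, hE⟩ = Multiplicative.ofAdd (0, 1, 0) →
      Φ ⟨uF, hF'⟩ = Multiplicative.ofAdd (0, 0, -1) →
      ∀ (x : SL(2, ℤ)), x ∈ Gamma q → ∃ i j k : ℤ, x * (uH ^ i * uE ^ j * uF ^ k)⁻¹ ∈ Gamma (q * p) := by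
    intro uH uE uF hH hE hF' h1 h2 h3 x hx
    obtain ⟨α, β, κ, δ, ha, hb, hc, hd⟩ := exists_entries_eq'' hx
    refine ⟨-α, β + α, α - κ, ?_⟩
    set UH : Gamma q := ⟨uH, hH⟩
    set UE : Gamma q := ⟨uE, hE⟩
    set UF : Gamma q := ⟨uF, hF'⟩
    set Xg : Gamma q := ⟨x, hx⟩
    have hval : Φ (Xg * (UH ^ (-α) * UE ^ (β + α) * UF ^ (α - κ))⁻¹) = 1 := by
      rw [map_mul, map_inv, map_mul, map_mul, map_zpow, map_zpow, map_zpow, h1, h2, h3,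
        P1 x hx α β κ ha hb hc, mul_inv_eq_one]
      apply Multiplicative.toAdd.injective
      simp only [toAdd_ofAdd, toAdd_mul, toAdd_zpow, Prod.smul_mk, Prod.mk_add_mk, zsmul_eq_mul]
      push_cast
      ext <;> ring
    have hmem := P3 _ (Xg * (UH ^ (-α) * UE ^ (β + α) * UF ^ (α - κ))⁻¹).2 hval
    simpa [Xg, UH, UE, UF] using hmem
  exact ⟨Φ, P1, P2, P3, P4, P5, P6, P7⟩

end UnboundedDenominators

end Literature.NumberTheory.Automorphic
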